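import Summits.QuantumFields.BalabanUV.T4Continuum.Support.NE7K1LinHomGramKernel

/-!
# NE7K1LinHomKerSpec — row NE7 (node U5), candidate route HOM, path H1L, cell K1-lin(s): THE SPECTRAL (ℓ²-NORM) BOUND OF THE
# ONE-DIMENSIONAL INTERPOLATION KERNEL — `Σ_t (Σ_Y k̃(t,Y)h_Y)² ≤ (6∕5)·L·Σ_Y h_Y²`

Lineage `b2b-balaban-t4-ne7-p2` (CRUX PROVER NE7 #2), generation 67 (first file; g66's OPEN item (4)(ii) «transverse factors
by the Gram matrix's ℓ²-NORM instead of its absolute row sum»).  The L-uniform upper two-run constant of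
`NE7K1LinHomGramUpper.schurB_form_le_gram` is `3·(37∕30)^d`: the bond factor `3` and, per transverse direction, the ABSOLUTE
ROW SUM `L + 2A + B ≤ (37∕30)L` of the interpolation kernel's Gram matrix (`NE7K1LinHomGramKernel.gramK_row_abs`; `A = Σℓ_j²`,
`B = Σℓ_jr_j < 0`).  A Schur ∕ row-sum test cannot see the SIGN of `B`; the operator (ℓ²) norm does: the Gram matrix's symbol is
`L + (A+B)(1 − cos θ) + |B| sin²θ`, with maximum `L + 2A + 2B` at `θ = π` when `A ≥ 3|B|` (`L ≥ 5`) and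
`L + A + (A+B)²∕(4|B|)` otherwise — both `< (6∕5)L`, and `(L + 2A + 2B)∕L ↑ 6∕5`.  This file proves, for EVERY `L ≥ 1` and every
coarse segment `[0,N)` (folded ends included), all [folklore]:

* §1 a two-regime scalar lemma (`scalar_two_regime`) and the two polynomial facts `2A + 2B ≤ L∕5`, `3A + B ≤ 2L∕5`
  (`two_sumA_add_two_sumB_le`, `three_sumA_add_sumB_le`; Faulhaber closed forms of `NE7K1LinHomGramSums`).
* §2 the kernel sum at a fine site `t = LX + j`: `Σ_Y k̃(t,Y)h_Y = h_X + p·(ℓ_j∕2)(h_{X−1} − h_X) + q·(r_j∕2)(h_{X+1} − h_X)`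
  (`kerF_sum_site`; `p = [1 ≤ X]`, `q = [X+1 < N]`), and the PER-BLOCK IDENTITY
  `Σ_{j<L}(v + (ℓ_j∕2)U + (r_j∕2)W)² = L·v² + (A∕4)(U² + W²) + (B∕2)·UW` (`block_sq_sum`) — the cross terms with `v` vanish because
  `Σℓ_j = Σr_j = 0` (exact block means).
* §3 reindexing on the segment and the three quadratic quantities `D₁ = Σ_X q_X(h_{X+1} − h_X)²` (bond energy of `h`),
  `S = Σ_X q_X(h_{X+1} + h_X)² + 2(h_0² + h_{N−1}²)`, `T = Σ_X (p_X(h_{X−1} − h_X) − q_X(h_{X+1} − h_X))²`: the parallelogram identity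
  `D₁ + S = 4‖h‖²` and the pointwise bounds `T ≤ 4‖h‖²`, `T ≤ 4S` (folded ends included).
* §4 **`kerF_sq_sum_le`**: `Σ_{t<NL} (Σ_{Y<N} k̃(t,Y)h_Y)² ≤ (6∕5)·L·Σ_{Y<N} h_Y²` — from the EXACT decomposition
  `Q = L‖h‖² + ((A+B)∕2)·D₁ + (|B|∕4)·T`; and its Gram form **`gramK_form_le`**: `Σ_{Y,Z} g_Y g_Z G(Y,Z) ≤ (6∕5)·L·Σ g²`.

Numbers (static python `g67/num/gramspec.py`): top eigenvalue ∕ L of the folded Gram matrix = 1.0625, 1.1111, 1.1415, 1.1612,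
1.1838, 1.1921 for L = 2, 3, 4, 5, 8, 12 (N ≤ 12), never above the periodic symbol maximum; `6∕5` is the `L → ∞` limit.

HONEST FRAMING: elementary real analysis of ONE explicit piecewise-quadratic kernel on `ℤ` ([folklore]); no lattice field, no
operator of Bałaban's; it serves a census ∕ NEEDS-CONSTANT sharpening of the L-uniform upper two-run constant at `A = 0`
(Gaussian, one RG step, `U = 1`, finite boxes).  FIXED FINITE T⁴, rung (B)+1; NE7 NOT PRINTED ∕ NOT PROVED; spine 0∕9; NOT infinite
volume, NOT mass gap, NOT Clay.  HONEST DEPENDENCY: continuum YM on T⁴ ⇐ BetaPertH ∧ nine spine estimates (0/9 proved); BetaPertH ⇐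
(D1) ∧ (D4) ∧ CAP+tail; G-an2-4 gates asym, D1 and NE2/3/4.
-/

noncomputable section

open Finset

namespace Summit.QuantumFields.BalabanUV.T4Continuum.NE7K1LinHomKerSpec

open NE7K1LinHomKernel NE7K1LinHomKernelSums NE7K1LinHomGramSums NE7K1LinHomGramKernel

/-! ### §1 The scalar lemma and the two polynomial facts -/

/-- **THE TWO-REGIME SCALAR LEMMA**: if `Q = L·G + ((A+B)∕2)·D + (|B|∕4)·T` with `B ≤ 0 ≤ A + B`, `D + S = 4G`, `T ≤ 4G`, `T ≤ 4S`
(`G, S ≥ 0`) and `2A + 2B ≤ L∕5`, `3A + B ≤ 2L∕5`, then `Q ≤ (6∕5)·L·G` (regime `A + 3B ≥ 0`: `Q ≤ (L + 2A + 2B)·G` via `T ≤ 4S`;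
regime `A + 3B < 0`: `Q ≤ (L + (3∕2)A + B∕2)·G` via the convex combination of the two bounds on `T`). [folklore] -/
theorem scalar_two_regime {L A B Q G D S T : ℝ} (hB : B ≤ 0) (hAB : 0 ≤ A + B) (hG : 0 ≤ G) (hS : 0 ≤ S)
    (hQ : Q = L * G + (A + B) / 2 * D + (-B) / 4 * T) (hDS : D + S = 4 * G) (hT1 : T ≤ 4 * G) (hT2 : T ≤ 4 * S)
    (p1 : 2 * A + 2 * B ≤ L / 5) (p2 : 3 * A + B ≤ 2 * L / 5) : Q ≤ 6 / 5 * L * G := by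
  have hD : D = 4 * G - S := by linarith
  rcases le_or_gt 0 (A + 3 * B) with h3 | h3
  · have h1 : (-B) / 4 * T ≤ (-B) * S := by
      have := mul_le_mul_of_nonneg_left hT2 (show 0 ≤ -B / 4 by linarith)
      linarith
    have h2 : 0 ≤ (A + 3 * B) / 2 * S := mul_nonneg (by linarith) hS
    have h4 : (2 * A + 2 * B) * G ≤ L / 5 * G := mul_le_mul_of_nonneg_right p1 hG
    rw [hQ, hD]
    nlinarith
  · have h1 : (A + B) * T ≤ (A + B) * (4 * S) := mul_le_mul_of_nonneg_left hT2 hAB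
    have h2 : (-2 * B - (A + B)) * T ≤ (-2 * B - (A + B)) * (4 * G) := mul_le_mul_of_nonneg_left hT1 (by linarith)
    have h4 : (3 * A + B) * G ≤ 2 * L / 5 * G := mul_le_mul_of_nonneg_right p2 hG
    rw [hQ, hD]
    nlinarith

section Poly

variable {L : ℕ}

/-- `2A + 2B ≤ L∕5` (`2A + 2B = (L²−1)(L²−4)∕(5L³)`, and `(L²−1)(L²−4) ≤ L⁴`). [folklore] -/
theorem two_sumA_add_two_sumB_le (hL : 1 ≤ L) :
    2 * ∑ j ∈ range L, shapeL L (j : ℤ) ^ 2 + 2 * ∑ j ∈ range L, shapeL L (j : ℤ) * shapeR L (j : ℤ) ≤ (L : ℝ) / 5 := by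
  rw [sum_shapeL_sq hL, sum_shapeL_mul_shapeR hL]
  have hL1 : (1 : ℝ) ≤ L := by exact_mod_cast hL
  have hL3 : (0 : ℝ) < (L : ℝ) ^ 3 := by positivity
  rw [show 2 * ((2 * (L : ℝ) ^ 2 - 3) * ((L : ℝ) ^ 2 - 1) / (15 * (L : ℝ) ^ 3)) +
      2 * (-(((L : ℝ) ^ 2 - 1) * ((L : ℝ) ^ 2 + 6)) / (30 * (L : ℝ) ^ 3)) =
      (((L : ℝ) ^ 2 - 1) * ((L : ℝ) ^ 2 - 4)) / (5 * (L : ℝ) ^ 3) by field_simp; ring]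
  rw [div_le_div_iff₀ (by positivity) (by norm_num)]
  nlinarith

/-- `3A + B ≤ 2L∕5` (`3A + B = (L²−1)(11L²−24)∕(30L³)`, and `(L²−1)(11L²−24) ≤ 12L⁴`). [folklore] -/
theorem three_sumA_add_sumB_le (hL : 1 ≤ L) :
    3 * ∑ j ∈ range L, shapeL L (j : ℤ) ^ 2 + ∑ j ∈ range L, shapeL L (j : ℤ) * shapeR L (j : ℤ) ≤ 2 * (L : ℝ) / 5 := by
  rw [sum_shapeL_sq hL, sum_shapeL_mul_shapeR hL]
  have hL1 : (1 : ℝ) ≤ L := by exact_mod_cast hL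
  have hL3 : (0 : ℝ) < (L : ℝ) ^ 3 := by positivity
  rw [show 3 * ((2 * (L : ℝ) ^ 2 - 3) * ((L : ℝ) ^ 2 - 1) / (15 * (L : ℝ) ^ 3)) +
      -(((L : ℝ) ^ 2 - 1) * ((L : ℝ) ^ 2 + 6)) / (30 * (L : ℝ) ^ 3) =
      (((L : ℝ) ^ 2 - 1) * (11 * (L : ℝ) ^ 2 - 24)) / (30 * (L : ℝ) ^ 3) by field_simp; ring]
  rw [div_le_div_iff₀ (by positivity) (by norm_num)]
  nlinarith

end Poly

/-! ### §2 The kernel sum at a fine site, and the per-block square sum -/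

section Site

variable {N L : ℕ}

/-- a label off the image of `range N` in `ℤ` is off the segment `[0,N)`. [folklore] -/
theorem not_seg_of_not_mem_image {Y : ℤ} (hY : Y ∉ (range N).image (Nat.cast : ℕ → ℤ)) : ¬ (0 ≤ Y ∧ Y < N) := by
  rintro ⟨h0, hN⟩
  exact hY (Finset.mem_image.2 ⟨Y.toNat, Finset.mem_range.2 (by omega), by omega⟩)

/-- **THE KERNEL SUM AT A FINE SITE** `t = LX + j`: `Σ_{Y<N} k̃(t,Y)h_Y = h_X + p·(ℓ_j∕2)(h_{X−1} − h_X) + q·(r_j∕2)(h_{X+1} − h_X)`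
with `p = [1 ≤ X]`, `q = [X+1 < N]` (three-point support and the three values of `NE7K1LinHomKernelSums`). [folklore] -/
theorem kerF_sum_site {X j : ℤ} (hX0 : 0 ≤ X) (hXN : X < N) (hj0 : 0 ≤ j) (hjL : j < L) (h : ℤ → ℝ) :
    ∑ Y ∈ range N, kerF N L (L * X + j) Y * h Y =
      h X + (if 1 ≤ X then (1 : ℝ) else 0) * (shapeL L j / 2) * (h (X - 1) - h X) +
        (if X + 1 < N then (1 : ℝ) else 0) * (shapeR L j / 2) * (h (X + 1) - h X) := by
  rw [sum_range_cast (fun Y => kerF N L (L * X + j) Y * h Y) N]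
  rw [sum_eq_three _ (fun Y => kerF N L (L * X + j) Y * h Y) X
    (fun Y hY => by rw [kerF_col_out _ (not_seg_of_not_mem_image hY), zero_mul])
    (fun Y h1 h2 h3 => by rw [kerF_far hX0 hXN hj0 hjL h1 h2 h3, zero_mul])]
  rw [kerF_pred_val hX0 hXN hj0 hjL, kerF_self_val hX0 hXN hj0 hjL, kerF_succ_val hX0 hXN hj0 hjL]
  ring

/-- **THE PER-BLOCK IDENTITY**: `Σ_{j<L}(v + (ℓ_j∕2)U + (r_j∕2)W)² = L·v² + (A∕4)(U² + W²) + (B∕2)·UW` — the cross terms with `v`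
vanish by `Σℓ_j = Σr_j = 0`; `A = Σℓ_j² = Σr_j²`, `B = Σℓ_jr_j`. [folklore] -/
theorem block_sq_sum (L : ℕ) (v U W : ℝ) :
    ∑ j ∈ range L, (v + shapeL L (j : ℤ) / 2 * U + shapeR L (j : ℤ) / 2 * W) ^ 2 =
      (L : ℝ) * v ^ 2 + (∑ j ∈ range L, shapeL L (j : ℤ) ^ 2) / 4 * (U ^ 2 + W ^ 2) +
        (∑ j ∈ range L, shapeL L (j : ℤ) * shapeR L (j : ℤ)) / 2 * (U * W) := by
  have key : ∀ j ∈ range L, (v + shapeL L (j : ℤ) / 2 * U + shapeR L (j : ℤ) / 2 * W) ^ 2 =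
      v ^ 2 + U ^ 2 / 4 * shapeL L (j : ℤ) ^ 2 + W ^ 2 / 4 * shapeR L (j : ℤ) ^ 2 + v * U * shapeL L (j : ℤ) +
        v * W * shapeR L (j : ℤ) + U * W / 2 * (shapeL L (j : ℤ) * shapeR L (j : ℤ)) := fun j _ => by ring
  rw [Finset.sum_congr rfl key, Finset.sum_add_distrib, Finset.sum_add_distrib, Finset.sum_add_distrib,
    Finset.sum_add_distrib, Finset.sum_add_distrib, Finset.sum_const, Finset.card_range, nsmul_eq_mul, ← Finset.mul_sum,
    ← Finset.mul_sum, ← Finset.mul_sum, ← Finset.mul_sum, ← Finset.mul_sum, sum_shapeL, sum_shapeR, sum_shapeR_sq]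
  ring

end Site

/-! ### §3 Reindexing on the segment; the parallelogram identity; the two pointwise bounds -/

section Reindex

variable {N : ℕ}

/-- shift down: `Σ_{X<N} [1 ≤ X]·f(X−1) = Σ_{X<N−1} f(X)`. [folklore] -/
theorem sum_ind_pred (f : ℤ → ℝ) (N : ℕ) :
    ∑ X ∈ range N, (if 1 ≤ (X : ℤ) then (1 : ℝ) else 0) * f ((X : ℤ) - 1) = ∑ X ∈ range (N - 1), f (X : ℤ) := by
  cases N with
  | zero => simp
  | succ n =>
    rw [Finset.sum_range_succ', if_neg (by norm_num), zero_mul, add_zero, Nat.add_sub_cancel]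
    exact Finset.sum_congr rfl fun X _ => by rw [if_pos (by push_cast; omega), one_mul]; congr 1; push_cast; ring

/-- drop the last site: `Σ_{X<N} [X+1 < N]·f(X) = Σ_{X<N−1} f(X)`. [folklore] -/
theorem sum_ind_succ_lt (f : ℤ → ℝ) (N : ℕ) :
    ∑ X ∈ range N, (if (X : ℤ) + 1 < N then (1 : ℝ) else 0) * f (X : ℤ) = ∑ X ∈ range (N - 1), f (X : ℤ) := by
  cases N with
  | zero => simp
  | succ n =>
    rw [Finset.sum_range_succ, if_neg (by push_cast; omega), zero_mul, add_zero, Nat.add_sub_cancel]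
    refine Finset.sum_congr rfl fun X hX => ?_
    have := Finset.mem_range.1 hX
    rw [if_pos (by push_cast; omega), one_mul]

/-- `Σ_{X<N−1} f(X) = Σ_{X<N} f(X) − f(N−1)` for `N ≥ 1`. [folklore] -/
theorem sum_range_pred_eq (f : ℤ → ℝ) (hN : 1 ≤ N) :
    ∑ X ∈ range (N - 1), f (X : ℤ) = ∑ X ∈ range N, f (X : ℤ) - f ((N : ℤ) - 1) := by
  obtain ⟨n, rfl⟩ : ∃ n, N = n + 1 := ⟨N - 1, by omega⟩
  rw [Nat.add_sub_cancel, Finset.sum_range_succ]; push_cast; ring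

/-- `Σ_{X<N−1} f(X+1) = Σ_{X<N} f(X) − f(0)` for `N ≥ 1`. [folklore] -/
theorem sum_range_pred_succ_eq (f : ℤ → ℝ) (hN : 1 ≤ N) :
    ∑ X ∈ range (N - 1), f ((X : ℤ) + 1) = ∑ X ∈ range N, f (X : ℤ) - f 0 := by
  obtain ⟨n, rfl⟩ : ∃ n, N = n + 1 := ⟨N - 1, by omega⟩
  rw [Nat.add_sub_cancel, Finset.sum_range_succ' (fun X => f (X : ℤ))]; push_cast; ring

/-- `Σ_{X<N} [1 ≤ X]·f(X) = Σ_{X<N} f(X) − f(0)` for `N ≥ 1`. [folklore] -/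
theorem sum_ind_one_le (f : ℤ → ℝ) (hN : 1 ≤ N) :
    ∑ X ∈ range N, (if 1 ≤ (X : ℤ) then (1 : ℝ) else 0) * f (X : ℤ) = ∑ X ∈ range N, f (X : ℤ) - f 0 := by
  obtain ⟨n, rfl⟩ : ∃ n, N = n + 1 := ⟨N - 1, by omega⟩
  rw [Finset.sum_range_succ', Finset.sum_range_succ' (fun X => f (X : ℤ)), if_neg (by norm_num)]
  push_cast
  rw [zero_mul, add_zero, add_sub_cancel_right]
  refine Finset.sum_congr rfl fun X _ => ?_
  rw [if_pos (by omega), one_mul]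

/-- `Σ_{X<N} [X+1 < N]·f(X) = Σ_{X<N} f(X) − f(N−1)` for `N ≥ 1`. [folklore] -/
theorem sum_ind_succ_lt' (f : ℤ → ℝ) (hN : 1 ≤ N) :
    ∑ X ∈ range N, (if (X : ℤ) + 1 < N then (1 : ℝ) else 0) * f (X : ℤ) = ∑ X ∈ range N, f (X : ℤ) - f ((N : ℤ) - 1) := by
  rw [sum_ind_succ_lt, sum_range_pred_eq f hN]

/-- `Σ_{X<N} [X+1 < N]·f(X+1) = Σ_{X<N} f(X) − f(0)` for `N ≥ 1`. [folklore] -/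
theorem sum_ind_succ_lt_succ (f : ℤ → ℝ) (hN : 1 ≤ N) :
    ∑ X ∈ range N, (if (X : ℤ) + 1 < N then (1 : ℝ) else 0) * f ((X : ℤ) + 1) = ∑ X ∈ range N, f (X : ℤ) - f 0 := by
  rw [sum_ind_succ_lt (fun X => f (X + 1)) N, sum_range_pred_succ_eq f hN]

end Reindex

section Quadratic

variable {N : ℕ}

/-- first pointwise bound: `(p(a − v) − q(b − v))² ≤ 2p·a² + 2q·b² + 2(2 − p − q)·v²` for `p, q ∈ {0,1}`. [folklore] -/
theorem pt_bound_one {p q : ℝ} (hp : p = 0 ∨ p = 1) (hq : q = 0 ∨ q = 1) (a b v : ℝ) :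
    (p * (a - v) - q * (b - v)) ^ 2 ≤ 2 * p * a ^ 2 + 2 * q * b ^ 2 + 2 * (2 - p - q) * v ^ 2 := by
  rcases hp with rfl | rfl <;> rcases hq with rfl | rfl <;>
    nlinarith [sq_nonneg (a + b), sq_nonneg (a + v), sq_nonneg (b + v), sq_nonneg v, sq_nonneg a, sq_nonneg b]

/-- second pointwise bound: `(p(a − v) − q(b − v))² ≤ 2p·(a + v)² + 2q·(b + v)² + 8(2 − p − q)·v²` for `p, q ∈ {0,1}`.
[folklore] -/
theorem pt_bound_two {p q : ℝ} (hp : p = 0 ∨ p = 1) (hq : q = 0 ∨ q = 1) (a b v : ℝ) :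
    (p * (a - v) - q * (b - v)) ^ 2 ≤ 2 * p * (a + v) ^ 2 + 2 * q * (b + v) ^ 2 + 8 * (2 - p - q) * v ^ 2 := by
  rcases hp with rfl | rfl <;> rcases hq with rfl | rfl <;>
    nlinarith [sq_nonneg (a + b + 2 * v), sq_nonneg (a + 3 * v), sq_nonneg (b + 3 * v), sq_nonneg v, sq_nonneg (a + v)]

/-- `p² = p` for an indicator. [folklore] -/
theorem ind_sq {p : ℝ} (hp : p = 0 ∨ p = 1) : p ^ 2 = p := by
  rcases hp with rfl | rfl <;> norm_num

/-- **THE PARALLELOGRAM IDENTITY ON THE SEGMENT**: with `q_X = [X+1 < N]`,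
`Σ_X q_X(h_{X+1} − h_X)² + (Σ_X q_X(h_{X+1} + h_X)² + 2(h_0² + h_{N−1}²)) = 4·Σ_X h_X²` (`N ≥ 1`). [folklore] -/
theorem bond_add_cobond (h : ℤ → ℝ) (hN : 1 ≤ N) :
    ∑ X ∈ range N, (if (X : ℤ) + 1 < N then (1 : ℝ) else 0) * (h ((X : ℤ) + 1) - h X) ^ 2 +
      (∑ X ∈ range N, (if (X : ℤ) + 1 < N then (1 : ℝ) else 0) * (h ((X : ℤ) + 1) + h X) ^ 2 +
        2 * (h 0 ^ 2 + h ((N : ℤ) - 1) ^ 2)) = 4 * ∑ X ∈ range N, h (X : ℤ) ^ 2 := by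
  have e : ∑ X ∈ range N, (if (X : ℤ) + 1 < N then (1 : ℝ) else 0) * (h ((X : ℤ) + 1) - h X) ^ 2 +
      ∑ X ∈ range N, (if (X : ℤ) + 1 < N then (1 : ℝ) else 0) * (h ((X : ℤ) + 1) + h X) ^ 2 =
      2 * ∑ X ∈ range N, (if (X : ℤ) + 1 < N then (1 : ℝ) else 0) * h ((X : ℤ) + 1) ^ 2 +
        2 * ∑ X ∈ range N, (if (X : ℤ) + 1 < N then (1 : ℝ) else 0) * h (X : ℤ) ^ 2 := by
    rw [Finset.mul_sum, Finset.mul_sum, ← Finset.sum_add_distrib, ← Finset.sum_add_distrib]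
    exact Finset.sum_congr rfl fun X _ => by ring
  rw [← add_assoc, e, sum_ind_succ_lt_succ (fun Y => h Y ^ 2) hN, sum_ind_succ_lt' (fun Y => h Y ^ 2) hN]
  ring

/-- **`T ≤ 4‖h‖²`**: `Σ_X (p_X(h_{X−1} − h_X) − q_X(h_{X+1} − h_X))² ≤ 4·Σ_X h_X²` (`N ≥ 1`; folded ends included). [folklore] -/
theorem twist_le_norm (h : ℤ → ℝ) (hN : 1 ≤ N) :
    ∑ X ∈ range N, ((if 1 ≤ (X : ℤ) then (1 : ℝ) else 0) * (h ((X : ℤ) - 1) - h X) -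
        (if (X : ℤ) + 1 < N then (1 : ℝ) else 0) * (h ((X : ℤ) + 1) - h X)) ^ 2 ≤ 4 * ∑ X ∈ range N, h (X : ℤ) ^ 2 := by
  have h1 : ∑ X ∈ range N, ((if 1 ≤ (X : ℤ) then (1 : ℝ) else 0) * (h ((X : ℤ) - 1) - h X) -
      (if (X : ℤ) + 1 < N then (1 : ℝ) else 0) * (h ((X : ℤ) + 1) - h X)) ^ 2 ≤
      ∑ X ∈ range N, (2 * (if 1 ≤ (X : ℤ) then (1 : ℝ) else 0) * h ((X : ℤ) - 1) ^ 2 +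
        2 * (if (X : ℤ) + 1 < N then (1 : ℝ) else 0) * h ((X : ℤ) + 1) ^ 2 +
        2 * (2 - (if 1 ≤ (X : ℤ) then (1 : ℝ) else 0) - (if (X : ℤ) + 1 < N then (1 : ℝ) else 0)) * h (X : ℤ) ^ 2) :=
    Finset.sum_le_sum fun X _ => pt_bound_one (ite_zero_or_one _) (ite_zero_or_one _) _ _ _
  refine h1.trans (le_of_eq ?_)
  have e : ∑ X ∈ range N, (2 * (if 1 ≤ (X : ℤ) then (1 : ℝ) else 0) * h ((X : ℤ) - 1) ^ 2 +
      2 * (if (X : ℤ) + 1 < N then (1 : ℝ) else 0) * h ((X : ℤ) + 1) ^ 2 +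
      2 * (2 - (if 1 ≤ (X : ℤ) then (1 : ℝ) else 0) - (if (X : ℤ) + 1 < N then (1 : ℝ) else 0)) * h (X : ℤ) ^ 2) =
      2 * ∑ X ∈ range N, (if 1 ≤ (X : ℤ) then (1 : ℝ) else 0) * h ((X : ℤ) - 1) ^ 2 +
      2 * ∑ X ∈ range N, (if (X : ℤ) + 1 < N then (1 : ℝ) else 0) * h ((X : ℤ) + 1) ^ 2 +
      (4 * ∑ X ∈ range N, h (X : ℤ) ^ 2 - 2 * ∑ X ∈ range N, (if 1 ≤ (X : ℤ) then (1 : ℝ) else 0) * h (X : ℤ) ^ 2 -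
        2 * ∑ X ∈ range N, (if (X : ℤ) + 1 < N then (1 : ℝ) else 0) * h (X : ℤ) ^ 2) := by
    rw [Finset.mul_sum, Finset.mul_sum, Finset.mul_sum, Finset.mul_sum, Finset.mul_sum, ← Finset.sum_sub_distrib,
      ← Finset.sum_sub_distrib, ← Finset.sum_add_distrib, ← Finset.sum_add_distrib]
    exact Finset.sum_congr rfl fun X _ => by ring
  rw [e, sum_ind_pred (fun Y => h Y ^ 2) N, sum_range_pred_eq (fun Y => h Y ^ 2) hN,
    sum_ind_succ_lt_succ (fun Y => h Y ^ 2) hN, sum_ind_one_le (fun Y => h Y ^ 2) hN, sum_ind_succ_lt' (fun Y => h Y ^ 2) hN]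
  ring

/-- **`T ≤ 4S`**: `Σ_X (p_X(h_{X−1} − h_X) − q_X(h_{X+1} − h_X))² ≤ 4·(Σ_X q_X(h_{X+1} + h_X)² + 2(h_0² + h_{N−1}²))` (`N ≥ 1`).
[folklore] -/
theorem twist_le_cobond (h : ℤ → ℝ) (hN : 1 ≤ N) :
    ∑ X ∈ range N, ((if 1 ≤ (X : ℤ) then (1 : ℝ) else 0) * (h ((X : ℤ) - 1) - h X) -
        (if (X : ℤ) + 1 < N then (1 : ℝ) else 0) * (h ((X : ℤ) + 1) - h X)) ^ 2 ≤
      4 * (∑ X ∈ range N, (if (X : ℤ) + 1 < N then (1 : ℝ) else 0) * (h ((X : ℤ) + 1) + h X) ^ 2 +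
        2 * (h 0 ^ 2 + h ((N : ℤ) - 1) ^ 2)) := by
  have h1 : ∑ X ∈ range N, ((if 1 ≤ (X : ℤ) then (1 : ℝ) else 0) * (h ((X : ℤ) - 1) - h X) -
      (if (X : ℤ) + 1 < N then (1 : ℝ) else 0) * (h ((X : ℤ) + 1) - h X)) ^ 2 ≤
      ∑ X ∈ range N, (2 * (if 1 ≤ (X : ℤ) then (1 : ℝ) else 0) * (h ((X : ℤ) - 1) + h X) ^ 2 +
        2 * (if (X : ℤ) + 1 < N then (1 : ℝ) else 0) * (h ((X : ℤ) + 1) + h X) ^ 2 +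
        8 * (2 - (if 1 ≤ (X : ℤ) then (1 : ℝ) else 0) - (if (X : ℤ) + 1 < N then (1 : ℝ) else 0)) * h (X : ℤ) ^ 2) :=
    Finset.sum_le_sum fun X _ => pt_bound_two (ite_zero_or_one _) (ite_zero_or_one _) _ _ _
  refine h1.trans (le_of_eq ?_)
  have e : ∑ X ∈ range N, (2 * (if 1 ≤ (X : ℤ) then (1 : ℝ) else 0) * (h ((X : ℤ) - 1) + h X) ^ 2 +
      2 * (if (X : ℤ) + 1 < N then (1 : ℝ) else 0) * (h ((X : ℤ) + 1) + h X) ^ 2 +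
      8 * (2 - (if 1 ≤ (X : ℤ) then (1 : ℝ) else 0) - (if (X : ℤ) + 1 < N then (1 : ℝ) else 0)) * h (X : ℤ) ^ 2) =
      2 * ∑ X ∈ range N, (if 1 ≤ (X : ℤ) then (1 : ℝ) else 0) * (h ((X : ℤ) - 1) + h (((X : ℤ) - 1) + 1)) ^ 2 +
      2 * ∑ X ∈ range N, (if (X : ℤ) + 1 < N then (1 : ℝ) else 0) * (h ((X : ℤ) + 1) + h X) ^ 2 +
      (16 * ∑ X ∈ range N, h (X : ℤ) ^ 2 - 8 * ∑ X ∈ range N, (if 1 ≤ (X : ℤ) then (1 : ℝ) else 0) * h (X : ℤ) ^ 2 -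
        8 * ∑ X ∈ range N, (if (X : ℤ) + 1 < N then (1 : ℝ) else 0) * h (X : ℤ) ^ 2) := by
    rw [Finset.mul_sum, Finset.mul_sum, Finset.mul_sum, Finset.mul_sum, Finset.mul_sum, ← Finset.sum_sub_distrib,
      ← Finset.sum_sub_distrib, ← Finset.sum_add_distrib, ← Finset.sum_add_distrib]
    exact Finset.sum_congr rfl fun X _ => by rw [sub_add_cancel]; ring
  rw [e, sum_ind_pred (fun Y => (h Y + h (Y + 1)) ^ 2) N, ← sum_ind_succ_lt (fun Y => (h Y + h (Y + 1)) ^ 2) N,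
    sum_ind_one_le (fun Y => h Y ^ 2) hN, sum_ind_succ_lt' (fun Y => h Y ^ 2) hN]
  have e2 : ∑ X ∈ range N, (if (X : ℤ) + 1 < N then (1 : ℝ) else 0) * (h (X : ℤ) + h ((X : ℤ) + 1)) ^ 2 =
      ∑ X ∈ range N, (if (X : ℤ) + 1 < N then (1 : ℝ) else 0) * (h ((X : ℤ) + 1) + h X) ^ 2 :=
    Finset.sum_congr rfl fun X _ => by rw [add_comm (h (X : ℤ))]
  rw [e2]
  ring

end Quadratic

/-! ### §4 The spectral bound of the interpolation kernel -/

section Main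

variable {N L : ℕ}

/-- the squared kernel sums, block by block: `Q = Σ_X Σ_{j<L}(h_X + p(ℓ_j∕2)(h_{X−1} − h_X) + q(r_j∕2)(h_{X+1} − h_X))²`. [folklore] -/
theorem sq_sum_blocks (h : ℤ → ℝ) :
    ∑ t ∈ range (N * L), (∑ Y ∈ range N, kerF N L t Y * h Y) ^ 2 =
      ∑ X ∈ range N, ∑ j ∈ range L, (h X + shapeL L (j : ℤ) / 2 *
        ((if 1 ≤ (X : ℤ) then (1 : ℝ) else 0) * (h ((X : ℤ) - 1) - h X)) +
          shapeR L (j : ℤ) / 2 * ((if (X : ℤ) + 1 < N then (1 : ℝ) else 0) * (h ((X : ℤ) + 1) - h X))) ^ 2 := by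
  rw [sum_range_mul (fun t => (∑ Y ∈ range N, kerF N L t Y * h Y) ^ 2) N L]
  push_cast
  refine Finset.sum_congr rfl fun X hX => Finset.sum_congr rfl fun j hj => ?_
  have hXN : (X : ℤ) < N := by exact_mod_cast Finset.mem_range.1 hX
  have hjL : (j : ℤ) < L := by exact_mod_cast Finset.mem_range.1 hj
  rw [kerF_sum_site (by positivity) hXN (by positivity) hjL h]
  ring

/-- **THE EXACT DECOMPOSITION**: `Q = L·‖h‖² + ((A+B)∕2)·D₁ + (|B|∕4)·T`, `D₁ = Σ_X q_X(h_{X+1} − h_X)²`,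
`T = Σ_X (p_X(h_{X−1} − h_X) − q_X(h_{X+1} − h_X))²`. [folklore] -/
theorem sq_sum_decomp (h : ℤ → ℝ) :
    ∑ t ∈ range (N * L), (∑ Y ∈ range N, kerF N L t Y * h Y) ^ 2 =
      (L : ℝ) * ∑ X ∈ range N, h (X : ℤ) ^ 2 +
      (∑ j ∈ range L, shapeL L (j : ℤ) ^ 2 + ∑ j ∈ range L, shapeL L (j : ℤ) * shapeR L (j : ℤ)) / 2 *
        ∑ X ∈ range N, (if (X : ℤ) + 1 < N then (1 : ℝ) else 0) * (h ((X : ℤ) + 1) - h X) ^ 2 +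
      (-(∑ j ∈ range L, shapeL L (j : ℤ) * shapeR L (j : ℤ))) / 4 *
        ∑ X ∈ range N, ((if 1 ≤ (X : ℤ) then (1 : ℝ) else 0) * (h ((X : ℤ) - 1) - h X) -
          (if (X : ℤ) + 1 < N then (1 : ℝ) else 0) * (h ((X : ℤ) + 1) - h X)) ^ 2 := by
  rw [sq_sum_blocks]
  set A : ℝ := ∑ j ∈ range L, shapeL L (j : ℤ) ^ 2 with hA
  set B : ℝ := ∑ j ∈ range L, shapeL L (j : ℤ) * shapeR L (j : ℤ) with hB
  have hblock : ∀ X ∈ range N, ∑ j ∈ range L, (h X + shapeL L (j : ℤ) / 2 *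
      ((if 1 ≤ (X : ℤ) then (1 : ℝ) else 0) * (h ((X : ℤ) - 1) - h X)) +
        shapeR L (j : ℤ) / 2 * ((if (X : ℤ) + 1 < N then (1 : ℝ) else 0) * (h ((X : ℤ) + 1) - h X))) ^ 2 =
      (L : ℝ) * h (X : ℤ) ^ 2 +
      (A + B) / 4 * ((if 1 ≤ (X : ℤ) then (1 : ℝ) else 0) * (h ((X : ℤ) - 1) - h X) ^ 2 +
        (if (X : ℤ) + 1 < N then (1 : ℝ) else 0) * (h ((X : ℤ) + 1) - h X) ^ 2) +
      (-B) / 4 * ((if 1 ≤ (X : ℤ) then (1 : ℝ) else 0) * (h ((X : ℤ) - 1) - h X) -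
        (if (X : ℤ) + 1 < N then (1 : ℝ) else 0) * (h ((X : ℤ) + 1) - h X)) ^ 2 := by
    intro X _
    rw [block_sq_sum L (h X) _ _, ← hA, ← hB]
    have hp := ind_sq (ite_zero_or_one (1 ≤ (X : ℤ)))
    have hq := ind_sq (ite_zero_or_one ((X : ℤ) + 1 < N))
    set p : ℝ := if 1 ≤ (X : ℤ) then (1 : ℝ) else 0
    set q : ℝ := if (X : ℤ) + 1 < N then (1 : ℝ) else 0
    have e1 : (p * (h ((X : ℤ) - 1) - h X)) ^ 2 = p * (h ((X : ℤ) - 1) - h X) ^ 2 := by rw [mul_pow, hp]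
    have e2 : (q * (h ((X : ℤ) + 1) - h X)) ^ 2 = q * (h ((X : ℤ) + 1) - h X) ^ 2 := by rw [mul_pow, hq]
    have e3 : (p * (h ((X : ℤ) - 1) - h X) - q * (h ((X : ℤ) + 1) - h X)) ^ 2 =
        p * (h ((X : ℤ) - 1) - h X) ^ 2 + q * (h ((X : ℤ) + 1) - h X) ^ 2 -
          2 * (p * (h ((X : ℤ) - 1) - h X)) * (q * (h ((X : ℤ) + 1) - h X)) := by
      rw [sub_sq, e1, e2]; ring
    rw [e1, e2, e3]
    ring
  rw [Finset.sum_congr rfl hblock, Finset.sum_add_distrib, Finset.sum_add_distrib, ← Finset.mul_sum, ← Finset.mul_sum,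
    ← Finset.mul_sum, Finset.sum_add_distrib]
  have e0 : ∑ X ∈ range N, (if 1 ≤ (X : ℤ) then (1 : ℝ) else 0) * (h ((X : ℤ) - 1) - h X) ^ 2 =
      ∑ X ∈ range N, (if 1 ≤ (X : ℤ) then (1 : ℝ) else 0) * (fun Y => (h Y - h (Y + 1)) ^ 2) ((X : ℤ) - 1) :=
    Finset.sum_congr rfl fun X _ => by simp only [sub_add_cancel]
  have e : ∑ X ∈ range N, (if (X : ℤ) + 1 < N then (1 : ℝ) else 0) * (fun Y => (h Y - h (Y + 1)) ^ 2) (X : ℤ) =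
      ∑ X ∈ range N, (if (X : ℤ) + 1 < N then (1 : ℝ) else 0) * (h ((X : ℤ) + 1) - h X) ^ 2 :=
    Finset.sum_congr rfl fun X _ => by simp only; rw [← neg_sub, neg_sq]
  rw [e0, sum_ind_pred (fun Y => (h Y - h (Y + 1)) ^ 2) N, ← sum_ind_succ_lt (fun Y => (h Y - h (Y + 1)) ^ 2) N, e]
  ring

/-- **THE SPECTRAL BOUND OF THE INTERPOLATION KERNEL**: for every `L ≥ 1`, every coarse segment `[0,N)` and every `h`,
`Σ_{t<NL} (Σ_{Y<N} k̃(t,Y)·h_Y)² ≤ (6∕5)·L·Σ_{Y<N} h_Y²` — the ℓ²-operator norm of the folded interpolation kernel is at most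
`√((6∕5)L)`; `6∕5` is the `L → ∞` limit of the periodic symbol maximum `(L + 2A + 2B)∕L` (against the absolute row sum
`(L + 2A + B)∕L ↑ 37∕30` of `NE7K1LinHomGramKernel.gramK_row_abs`). [folklore] -/
theorem kerF_sq_sum_le (hL : 1 ≤ L) (h : ℤ → ℝ) :
    ∑ t ∈ range (N * L), (∑ Y ∈ range N, kerF N L t Y * h Y) ^ 2 ≤ 6 / 5 * (L : ℝ) * ∑ Y ∈ range N, h (Y : ℤ) ^ 2 := by
  rcases Nat.eq_zero_or_pos N with hN0 | hN
  · subst hN0; simp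
  exact scalar_two_regime (sumB_nonpos hL) (sumA_add_sumB_nonneg L) (Finset.sum_nonneg fun _ _ => sq_nonneg _)
    (add_nonneg (Finset.sum_nonneg fun X _ => mul_nonneg (by split_ifs <;> norm_num) (sq_nonneg _)) (by positivity))
    (sq_sum_decomp h) (bond_add_cobond h hN) (twist_le_norm h hN) (twist_le_cobond h hN)
    (two_sumA_add_two_sumB_le hL) (three_sumA_add_sumB_le hL)

/-- the Gram form as a sum of squared kernel sums: `Σ_{Y,Z} g_Y g_Z G(Y,Z) = Σ_t (Σ_Y k̃(t,Y)g_Y)²`. [folklore] -/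
theorem gramK_form_eq (g : ℤ → ℝ) :
    ∑ Y ∈ range N, ∑ Z ∈ range N, g Y * g Z * gramK N L Y Z =
      ∑ t ∈ range (N * L), (∑ Y ∈ range N, kerF N L t Y * g Y) ^ 2 := by
  unfold gramK
  have e : ∀ t ∈ range (N * L), (∑ Y ∈ range N, kerF N L t Y * g Y) ^ 2 =
      ∑ Y ∈ range N, ∑ Z ∈ range N, g Y * g Z * (kerF N L t Y * kerF N L t Z) := by
    intro t _
    rw [sq, Finset.sum_mul_sum]
    exact Finset.sum_congr rfl fun Y _ => Finset.sum_congr rfl fun Z _ => by ring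
  rw [eq_comm, Finset.sum_congr rfl e, Finset.sum_comm]
  refine Finset.sum_congr rfl fun Y _ => ?_
  rw [Finset.sum_comm]
  exact Finset.sum_congr rfl fun Z _ => by rw [Finset.mul_sum]

/-- **THE GRAM MATRIX OF THE INTERPOLATION KERNEL IS `⪯ (6∕5)·L`**: `Σ_{Y,Z<N} g_Y g_Z G(Y,Z) ≤ (6∕5)·L·Σ_{Y<N} g_Y²` for every
`L ≥ 1` — the form (Löwner) bound replacing the absolute row sum `(37∕30)·L`. [folklore] -/
theorem gramK_form_le (hL : 1 ≤ L) (g : ℤ → ℝ) :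
    ∑ Y ∈ range N, ∑ Z ∈ range N, g Y * g Z * gramK N L Y Z ≤ 6 / 5 * (L : ℝ) * ∑ Y ∈ range N, g (Y : ℤ) ^ 2 := by
  rw [gramK_form_eq]
  exact kerF_sq_sum_le hL g

end Main

end Summit.QuantumFields.BalabanUV.T4Continuum.NE7K1LinHomKerSpec
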